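import Literature.Topology.FourManifolds.TrisectionSectorCollars
import Literature.Topology.FourManifolds.TrisectionFunctorGKProofs
import Literature.AlgebraicTopology.FundamentalGroup.VanKampenClosedCover
import HarnessLib

/-!
# The topological inputs (T1)–(T3) of Abrams–Gay–Kirby's fact (a′), proved

Topic `Literature/Topology/FourManifolds` (fact seat
`provefact-Literature.Topology.FourManifolds.isGroupTrisection_groupGKTrisectionOf`).  The
reduction `isGroupTrisection_groupGKTrisectionOf_of_fundamentalGroup` (`TrisectionFunctorGKProofs.lean`)
of fact (a′) — Abrams–Gay–Kirby (2018), p. 1540: the map `𝒢` from trisected 4-manifolds to group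
trisections is well defined — asks for four topological inputs (T1)–(T4) about a Gay–Kirby
trisection `S` of `X` (`IsGKTrisection`; central surface `F = ⋂ l, S l`, handlebodies
`Hᵢ = S (i+1) ∩ S (i+2)`, sectors `S l` with `∂X_l = S l ∩ (S (l+1) ∪ S (l+2))`).  This file
**proves (T1), (T2), (T3)**, in the `VanKampen.inclHomOfSubset` vocabulary and at every base
point of `F`:

* (T1) `IsGKTrisection.surjective_inclHomOfSubset_handlebody`,
  `IsGKTrisection.isFreeOfRank_fundamentalGroup_handlebody` — `π₁(F) → π₁(Hᵢ)` is onto and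
  `π₁(Hᵢ) ≅ F_g`: the Morse theory of `1`-handlebodies
  (`OneHandlebodyFundamentalGroup.lean`, `OneHandlebodyBoundaryFundamentalGroup.lean`) for the
  abstract handlebody `H` of clause (iii), transported along its embedding
  (`InclHomTransport.lean`);
* (T2) `IsGKTrisection.surjective_and_ker_eq_handlebody_union` — `π₁(F) → π₁(Hᵢ ∪ Hᵢ₊₁)` is onto
  with kernel `⟪ker (π₁ F → π₁ Hᵢ) ∪ ker (π₁ F → π₁ Hᵢ₊₁)⟫`: Seifert–van Kampen for the Heegaard
  splitting `Hᵢ ∪_F Hᵢ₊₁` (`VanKampenClosedCover.lean`, collars from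
  `TrisectionSectorCollars.lean`);
* (T3) `IsGKTrisection.bijective_inclHomOfSubset_sectorBoundary`,
  `IsGKTrisection.isFreeOfRank_fundamentalGroup_sectorBoundary` — `π₁(∂X_l) → π₁(X_l)` is an
  isomorphism and `π₁(∂X_l) ≅ F_{k_l}` (Morse theory of the `4`-dimensional `1`-handlebody `W`
  of clause (ii); `∂X_l = e(∂W)` by invariance of the boundary);
* `IsGKTrisection.isFreeOfRank_quotient_pair` — hence the pairwise pushout
  `π₁(F) ⧸ ⟪Kᵢ ∪ Kᵢ₊₁⟫ ≅ π₁(Hᵢ ∪ Hᵢ₊₁) = π₁(∂X_{i+2})` is free of rank `k (i+2)` (the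
  hypothesis `pair` of the reduction, in the normalised indexing `(i, i+1)`).

Everything is proved; no definitions, no named facts.  (T4) — van Kampen for the three sectors
— is the sibling `TrisectionFunctorGKVanKampen.lean`.

## References

* A. Abrams, D. Gay, R. Kirby, *Group trisections and smooth 4-manifolds*, Geom. Topol. 22 (2018),
  p. 1540 (the map `𝒢`), Def. 1 (p. 1538). [AbramsGayKirby2018]
* D. Gay, R. Kirby, *Trisecting 4-manifolds*, Geom. Topol. 20 (2016), Def. 1. [GayKirby2016]
* A. Hatcher, *Algebraic Topology* (2002), Thm. 1.20, Prop. 1.26. [HatcherAT2002]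
-/

noncomputable section

open Set Function Filter Topology
open scoped Manifold ContDiff

namespace Literature.Topology.FourManifolds

open Literature.AlgebraicTopology Literature.AlgebraicTopology.FundamentalGroup
  Literature.AlgebraicTopology.FundamentalGroup.VanKampen

universe u

/-! ### Bookkeeping: rewriting sets and base points -/

section Congr

variable {Y : Type*} [TopologicalSpace Y]

/-- Moving the base point along an equality of points does not change surjectivity of
`inclHomOfSubset`. [folklore] -/
theorem surjective_inclHomOfSubset_congr_pt {S T : Set Y} (h : S ⊆ T) {x x' : Y} (e : x = x')
    (hx : x ∈ S) (hx' : x' ∈ S) :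
    Function.Surjective (inclHomOfSubset h x hx (h hx)) ↔
      Function.Surjective (inclHomOfSubset h x' hx' (h hx')) := by
  subst e
  exact Iff.rfl

/-- Moving the base point along an equality of points does not change injectivity of
`inclHomOfSubset`. [folklore] -/
theorem injective_inclHomOfSubset_congr_pt {S T : Set Y} (h : S ⊆ T) {x x' : Y} (e : x = x')
    (hx : x ∈ S) (hx' : x' ∈ S) :
    Function.Injective (inclHomOfSubset h x hx (h hx)) ↔
      Function.Injective (inclHomOfSubset h x' hx' (h hx')) := by
  subst e
  exact Iff.rfl

/-- Equal subspaces at equal base points have isomorphic fundamental groups. [folklore] -/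
theorem nonempty_fundamentalGroup_mulEquiv_of_eq_of_eq {S S' : Set Y} (eS : S = S') {x x' : Y}
    (ex : x = x') (hx : x ∈ S) (hx' : x' ∈ S') :
    Nonempty (FundamentalGroup S ⟨x, hx⟩ ≃* FundamentalGroup S' ⟨x', hx'⟩) := by
  subst eS ex
  exact ⟨MulEquiv.refl _⟩

end Congr

/-! ### (T1)–(T3) -/

section Inputs

variable {X : Type u} [TopologicalSpace X] [T2Space X] [SecondCountableTopology X]
  [ChartedSpace (EuclideanSpace ℝ (Fin 4)) X] {g : ℕ} {k : Fin 3 → ℕ} {S : Fin 3 → Set X}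

/-- **(T1), surjectivity: `π₁(F) → π₁(Hᵢ)` is onto.**  For a Gay–Kirby trisection, the map
induced on fundamental groups by the inclusion of the central surface `F = ⋂ l, S l` in the
handlebody `Hᵢ = S (i+1) ∩ S (i+2)` is surjective at every base point of `F`: `Hᵢ = h(H)` for a
compact connected `3`-dimensional `1`-handlebody `H` with `h(∂H) = F` (clause (iii)), and
`π₁(∂H) → π₁(H)` is onto (`HasHandleDecomposition.surjective_inclHom_boundary`, Morse theory),
transported along the embedding `h`. [cite: AbramsGayKirby2018, p. 1540 (the map 𝒢: S_g ↠ H_g)] -/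
theorem IsGKTrisection.surjective_inclHomOfSubset_handlebody (h : IsGKTrisection X g k S)
    (i : Fin 3) {x : X} (hx : x ∈ ⋂ l, S l) :
    Function.Surjective (inclHomOfSubset (iInter_subset_inter S i) x hx (iInter_subset_inter S i hx)) := by
  obtain ⟨H, _, _, f, hM, hH, hc, hh, hf, hrange, hbdry⟩ := h.2.2 (i + 1) (i + 2) (fin3_succ_ne i).2.2
  haveI := hM
  haveI := hH
  haveI := hc
  haveI : T2Space H := hf.isEmbedding.t2Space
  haveI : SecondCountableTopology H := hf.isEmbedding.secondCountableTopology
  have hx' : x ∈ f '' (𝓡∂ 3).boundary H := by rw [hbdry]; exact hx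
  obtain ⟨z, hz, hzx⟩ := hx'
  have hs := hh.surjective_inclHom_boundary (handleCount_zero 1 g)
    (fun j hj => handleCount_of_two_le 1 g hj) le_rfl hz
  have hs' := (surjective_inclHom_iff_image_of_isEmbedding hf.isEmbedding hz).1 hs
  rw [surjective_inclHomOfSubset_congr' hbdry hrange (image_subset_range f _) (iInter_subset_inter S i)
    (mem_image_of_mem f hz) (hbdry ▸ mem_image_of_mem f hz)] at hs'
  exact (surjective_inclHomOfSubset_congr_pt _ hzx _ hx).1 hs'

/-- **(T1), freeness: `π₁(Hᵢ) ≅ F_g`.**  The fundamental group of the handlebody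
`Hᵢ = S (i+1) ∩ S (i+2)` of a Gay–Kirby trisection is free of rank `g` at every base point of the
central surface: `Hᵢ ≅ H`, a compact connected `3`-manifold with one `0`-handle and `g`
`1`-handles, whose `π₁` is `F_g` (`HasHandleDecomposition.isFreeOfRank_fundamentalGroup`, Morse
theory). [cite: AbramsGayKirby2018, p. 1540 (π₁(H_ij) ≅ F_g)] -/
theorem IsGKTrisection.isFreeOfRank_fundamentalGroup_handlebody (h : IsGKTrisection X g k S)
    (i : Fin 3) {x : X} (hx : x ∈ ⋂ l, S l) :
    IsFreeOfRank (FundamentalGroup ↥(S (i + 1) ∩ S (i + 2)) ⟨x, iInter_subset_inter S i hx⟩) g := by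
  obtain ⟨H, _, _, f, hM, hH, hc, hh, hf, hrange, hbdry⟩ := h.2.2 (i + 1) (i + 2) (fin3_succ_ne i).2.2
  haveI := hM
  haveI := hH
  haveI := hc
  haveI : T2Space H := hf.isEmbedding.t2Space
  haveI : SecondCountableTopology H := hf.isEmbedding.secondCountableTopology
  have hx' : x ∈ f '' (𝓡∂ 3).boundary H := by rw [hbdry]; exact hx
  obtain ⟨z, -, hzx⟩ := hx'
  have hfree := hh.isFreeOfRank_fundamentalGroup rfl rfl (fun j hj => handleCount_of_two_le 1 g hj) z
  let θ : FundamentalGroup H z ≃* FundamentalGroup ↥(range f) ⟨f z, mem_range_self z⟩ :=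
    fundamentalGroupEquivOfHomeomorph hf.isEmbedding.toHomeomorph rfl
  obtain ⟨e⟩ := nonempty_fundamentalGroup_mulEquiv_of_eq_of_eq hrange hzx (mem_range_self z)
    (iInter_subset_inter S i hx)
  exact (hfree.of_mulEquiv θ).of_mulEquiv e

/-- **(T2): van Kampen for the Heegaard splitting `Hᵢ ∪_F Hᵢ₊₁`.**  For a Gay–Kirby trisection
and a base point `x` of the central surface `F`, the map `π₁(F, x) → π₁(Hᵢ ∪ Hᵢ₊₁, x)` induced
by the inclusion is surjective with kernel the normal closure of
`ker (π₁ F → π₁ Hᵢ) ∪ ker (π₁ F → π₁ Hᵢ₊₁)`: Seifert–van Kampen for the two closed handlebodies,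
collared along their common boundary `F` inside themselves
(`VanKampen.surjective_and_ker_eq_of_closed_cover_collars` with the collars of
`IsGKTrisection.exists_collar_centralSurface`, and (T1)). [cite: AbramsGayKirby2018, p. 1540 (the map 𝒢)] [cite: HatcherAT2002, Thm. 1.20] -/
theorem IsGKTrisection.surjective_and_ker_eq_handlebody_union (h : IsGKTrisection X g k S)
    (i : Fin 3) {x : X} (hx : x ∈ ⋂ l, S l) :
    Function.Surjective (inclHomOfSubset
        ((iInter_subset_inter S i).trans subset_union_left :
          (⋂ l, S l) ⊆ (S (i + 1) ∩ S (i + 2)) ∪ (S (i + 1 + 1) ∩ S (i + 1 + 2))) x hx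
        (Or.inl (iInter_subset_inter S i hx))) ∧
      (inclHomOfSubset ((iInter_subset_inter S i).trans subset_union_left :
          (⋂ l, S l) ⊆ (S (i + 1) ∩ S (i + 2)) ∪ (S (i + 1 + 1) ∩ S (i + 1 + 2))) x hx
          (Or.inl (iInter_subset_inter S i hx))).ker =
        Subgroup.normalClosure
          (((inclHomOfSubset (iInter_subset_inter S i) x hx (iInter_subset_inter S i hx)).ker : Set _) ∪
            (inclHomOfSubset (iInter_subset_inter S (i + 1)) x hx
              (iInter_subset_inter S (i + 1) hx)).ker) := by
  obtain ⟨K₁, O₁, hO₁, hK₁, hFK₁, hsdr₁⟩ := h.exists_collar_centralSurface i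
  obtain ⟨K₂, O₂, hO₂, hK₂, hFK₂, hsdr₂⟩ := h.exists_collar_centralSurface (i + 1)
  exact surjective_and_ker_eq_of_closed_cover_collars
    ((h.isClosed _).inter (h.isClosed _)) ((h.isClosed _).inter (h.isClosed _))
    (iInter_subset_inter S i) (iInter_subset_inter S (i + 1)) (inter_handlebody_succ S i).le
    hO₁ hK₁ hFK₁ hO₂ hK₂ hFK₂ hsdr₁ hsdr₂ (h.isPathConnected_handlebody i)
    (h.isPathConnected_handlebody (i + 1)) h.isPathConnected_iInter hx
    (h.surjective_inclHomOfSubset_handlebody i hx) (h.surjective_inclHomOfSubset_handlebody (i + 1) hx)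

/-- **(T3), bijectivity: `π₁(∂X_l) → π₁(X_l)` is an isomorphism.**  For a sector `S l` of a
Gay–Kirby trisection and a base point `x` of `∂X_l = S l ∩ (S (l+1) ∪ S (l+2))` (the image of the
boundary of the abstract sector, `IsGKTrisection.image_boundary_eq`), the map
`π₁(∂X_l, x) → π₁(S l, x)` induced by the inclusion is bijective: `S l ≅ W`, a compact connected
`4`-dimensional `1`-handlebody, and `π₁(∂W) ≅ π₁(W)` (`HasHandleDecomposition.bijective_inclHom_boundary`,
Morse theory: the duals of the handles are cells of dimension `≥ 3`).
[cite: AbramsGayKirby2018, p. 1540 (π₁(∂X_i) ≅ π₁(X_i) ≅ F_k)] -/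
theorem IsGKTrisection.bijective_inclHomOfSubset_sectorBoundary (h : IsGKTrisection X g k S)
    (l : Fin 3) {x : X} (hx : x ∈ S l ∩ (S (l + 1) ∪ S (l + 2))) :
    Function.Bijective (inclHomOfSubset (inter_subset_left : S l ∩ (S (l + 1) ∪ S (l + 2)) ⊆ S l)
      x hx hx.1) := by
  obtain ⟨W, _, _, e, hM, hW, hc, hh, he, hrange, -, -, hbd⟩ := h.2.1 l
  haveI := hM
  haveI := hW
  haveI := hc
  haveI : T2Space W := he.t2Space
  haveI : SecondCountableTopology W := he.secondCountableTopology
  have hbdry := h.image_boundary_eq he hrange hbd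
  have hx' : x ∈ e '' (𝓡∂ 4).boundary W := by rw [hbdry]; exact hx
  obtain ⟨z, hz, hzx⟩ := hx'
  have hb := hh.bijective_inclHom_boundary (handleCount_zero 1 (k l))
    (fun j hj => handleCount_of_two_le 1 (k l) hj) le_rfl hz
  have hs := (surjective_inclHom_iff_image_of_isEmbedding he hz).1 hb.2
  have hi := (injective_inclHom_iff_image_of_isEmbedding he hz).1 hb.1
  rw [surjective_inclHomOfSubset_congr' hbdry hrange (image_subset_range e _) inter_subset_left
    (mem_image_of_mem e hz) (hbdry ▸ mem_image_of_mem e hz),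
    surjective_inclHomOfSubset_congr_pt _ hzx _ hx] at hs
  rw [injective_inclHomOfSubset_congr' hbdry hrange (image_subset_range e _) inter_subset_left
    (mem_image_of_mem e hz) (hbdry ▸ mem_image_of_mem e hz),
    injective_inclHomOfSubset_congr_pt _ hzx _ hx] at hi
  exact ⟨hi, hs⟩

/-- **(T3), freeness: `π₁(∂X_l) ≅ F_{k_l}`.**  The fundamental group of
`∂X_l = S l ∩ (S (l+1) ∪ S (l+2))` is free of rank `k l` at every base point: it is isomorphic to
`π₁(∂W) ≅ π₁(W) ≅ F_{k_l}` for the abstract sector `W`, a compact connected `4`-dimensional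
`1`-handlebody with `k l` `1`-handles (`HasHandleDecomposition.bijective_inclHom_boundary`,
`HasHandleDecomposition.isFreeOfRank_fundamentalGroup`). [cite: AbramsGayKirby2018, p. 1540 (π₁(∂X_i) ≅ F_k)] -/
theorem IsGKTrisection.isFreeOfRank_fundamentalGroup_sectorBoundary (h : IsGKTrisection X g k S)
    (l : Fin 3) {x : X} (hx : x ∈ S l ∩ (S (l + 1) ∪ S (l + 2))) :
    IsFreeOfRank (FundamentalGroup ↥(S l ∩ (S (l + 1) ∪ S (l + 2))) ⟨x, hx⟩) (k l) := by
  obtain ⟨W, _, _, e, hM, hW, hc, hh, he, hrange, -, -, hbd⟩ := h.2.1 l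
  haveI := hM
  haveI := hW
  haveI := hc
  haveI : T2Space W := he.t2Space
  haveI : SecondCountableTopology W := he.secondCountableTopology
  have hbdry := h.image_boundary_eq he hrange hbd
  have hx' : x ∈ e '' (𝓡∂ 4).boundary W := by rw [hbdry]; exact hx
  obtain ⟨z, hz, hzx⟩ := hx'
  have hb := hh.bijective_inclHom_boundary (handleCount_zero 1 (k l))
    (fun j hj => handleCount_of_two_le 1 (k l) hj) le_rfl hz
  have hfree := hh.isFreeOfRank_fundamentalGroup rfl rfl (fun j hj => handleCount_of_two_le 1 (k l) hj) z
  -- `π₁(∂W, z) ≅ π₁(W, z)` and `π₁(∂W, z) ≅ π₁(e(∂W), e z)`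
  let θ₁ := MulEquiv.ofBijective _ hb
  obtain ⟨θS, -, -⟩ := exists_mulEquiv_image_comm_of_isEmbedding he (S := (𝓡∂ 4).boundary W) hz
  obtain ⟨e'⟩ := nonempty_fundamentalGroup_mulEquiv_of_eq_of_eq hbdry hzx (mem_image_of_mem e hz) hx
  exact ((hfree.of_mulEquiv θ₁.symm).of_mulEquiv θS).of_mulEquiv e'

/-- **(T2) + (T3): the pairwise pushout is free of rank `k`.**  For a Gay–Kirby trisection and a
base point `x` of the central surface `F`, the quotient
`π₁(F, x) ⧸ ⟪ker (π₁ F → π₁ Hᵢ) ∪ ker (π₁ F → π₁ Hᵢ₊₁)⟫` is free of rank `k (i+2)`: by (T2) it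
is `π₁(Hᵢ ∪ Hᵢ₊₁, x) = π₁(∂X_{i+2}, x)`, free of rank `k (i+2)` by (T3).
[cite: AbramsGayKirby2018, p. 1540 (the map 𝒢) and Def. 1 (p. 1538)] -/
theorem IsGKTrisection.isFreeOfRank_quotient_pair (h : IsGKTrisection X g k S) (i : Fin 3)
    {x : X} (hx : x ∈ ⋂ l, S l) :
    IsFreeOfRank (FundamentalGroup ↥(⋂ l, S l) ⟨x, hx⟩ ⧸ Subgroup.normalClosure
      (((inclHomOfSubset (iInter_subset_inter S i) x hx (iInter_subset_inter S i hx)).ker : Set _) ∪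
        (inclHomOfSubset (iInter_subset_inter S (i + 1)) x hx
          (iInter_subset_inter S (i + 1) hx)).ker)) (k (i + 2)) := by
  obtain ⟨hsurj, hker⟩ := h.surjective_and_ker_eq_handlebody_union i hx
  have hxU : x ∈ (S (i + 1) ∩ S (i + 2)) ∪ (S (i + 1 + 1) ∩ S (i + 1 + 2)) :=
    Or.inl (iInter_subset_inter S i hx)
  have hxB : x ∈ S (i + 2) ∩ (S (i + 2 + 1) ∪ S (i + 2 + 2)) := by
    rw [← union_handlebody_succ]; exact hxU
  obtain ⟨e⟩ := nonempty_fundamentalGroup_mulEquiv_of_eq_of_eq (union_handlebody_succ S i) rfl hxU hxB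
  exact IsFreeOfRank.quotient_of_ker_eq _ hsurj hker
    ((h.isFreeOfRank_fundamentalGroup_sectorBoundary (i + 2) hxB).of_mulEquiv e.symm)

end Inputs

end Literature.Topology.FourManifolds
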